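import Summits.HodgeConjecture.HodgeCM.Literature.AlbaneseUnitaryShimuraModules
import HarnessLib

/-!
# Δ2 BRIDGE, PROPOSAL T — the ANTILINEAR transport frame for `Thm418Combined` (abstract half)

Cell pub-hodgecm2 (COR-CM), Δ2 bridge wall-breaker fan, seat wb-5 (prover-pub-hodgecm2-d2bridge-wb-5-g2-0), 2026-08-23;
sub-socket S-d «`Thm418C` symmetry under complex conjugation» in the form PROPOSAL T of the orientation auditor (own-crow g93,
HOME/INBOX 2026-08-23T22:22Z) needs: transport of the combined reading r8 along a CONJUGATE-LINEAR, `G`-equivariant involution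
`F∞ = conj ⊗ id` of the tower `H = colim_K H¹(X_K(ℂ); ℂ)`, which SWAPS the `μ`-blocks (`F∞ (block i) = block ī`) and carries the
CM classes keyed at `ι₁` to the CM classes keyed at `ῑ₁ = conj ∘ ι₁`.  The sibling `D2Bridge/Thm418CTransport.lean` (wb-10) is the
`ℂ`-LINEAR frame; a linear transport cannot swap Hodge types, so PROPOSAL T needs the antilinear one.  This file supplies its
ABSTRACT half; the model half (two keyings of the SAME tower, `LiuDictionary.ofTower`) is `D2Bridge/Thm418CConjTransportTower.lean`.

WHAT IS HERE (kernel only; Mathlib + the Literature leaf `AlbaneseUnitaryShimuraModules`; no instance, no named fact, no definition,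
nothing cited anew; Mathlib's star-semilinear currency `M →ₗ⋆[ℂ] M'` = `M →ₛₗ[starRingEnd ℂ] M'`, `M ≃ₗ⋆[ℂ] M'`).  For
`D : LiuAlbaneseModuleDatum G Kof`, `D' : LiuAlbaneseModuleDatum G' Kof'` and abstract geometric sides `(W, res, cmCl)`, `(W', res', cmCl')`:
* `map_mem_fixedBy_of_conjSemilinear` — fixed vectors under a `φ`-semilinear CONJUGATE-linear map;
* `map_oscImage_le_of_conjTransport`, `map_block_le_of_conjTransport`, `map_block_eq_of_conjTransport` — the block law DERIVED from
  conjugate-linear `G`-equivariant isomorphisms of the oscillator modules `eΩ a : ω(μ, a) ≃ₗ⋆[ℂ] ω'(μ', eA a)` (the socket the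
  «Weil module under complex conjugation» lemma (T4) plugs into);
* `thm418Combined_of_conjTransport` (pull-back, weakest one-sided hypotheses), `thm418Combined_conjTransport_of` (push-forward),
  `thm418Combined_iff_of_conjTransport` (equivalence) along a package `φ : G → G'`, `eL`, `eC : Char → Char'`, `eH : H →ₗ⋆[ℂ] H'`,
  `eW K : W K →ₗ⋆[ℂ] W' (eL K)` subject to the evident laws (cofinality of `eL`, `Kof' (eL K)` covered by `φ (Kof K)`, `φ`-semilinearity
  of `eH` on `Kof K`, `PhiMu → PhiMu'`, `eH (block μ) ≤ block' (eC μ)`, `eW ∘ res = res' ∘ eH`, `eW K` injective, `cmCl' ⊆ eW '' cmCl`).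
PROOFS: the one-vector chase of the linear sibling, verbatim, in semilinear currency (`Submodule.map_span` ∕ `map_iSup` hold for the
surjective ring endomorphism `starRingEnd ℂ`; the composite of two conjugate-linear maps is `ℂ`-linear — `RingHomInvPair.triples` —
which is what lets `MonoidAlgebra.equivariantOfLinearOfComm` rebuild a `ℂ[G']`-map out of `eH ∘ ψ ∘ θ`).
NON-VACUITY of the law family: a joint inhabitant is ANY pair of data whose carriers are complexifications `ℂ ⊗_ℚ (·)` of
`ℚ[G]`-modules with `eH, eW, eΩ := conj ⊗ id` throughout and `φ, eL, eC, eA := id` (every law then holds by `conj_baseChange`-naturality)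
— the tower of the model is of this form level-wise (`U.CohC X k := ℂ ⊗[ℚ] U.Coh X k`), which is what PROPOSAL T's sub-lemma (T1) records.
HC_CM is NOT proved; «Δ2 BRIDGE CLOSED» is NOT claimed; this file decides no orientation question — it is the frame in which the
four sub-lemmas (T1) tower involution, (T2) index involution, (T3′) CM-class conjugation, (T4) oscillator-module conjugation compose.

## References
* [Liu2021] Y. Liu, *Fourier–Jacobi cycles and arithmetic relative trace formula*, Camb. J. Math. 9 (2021) = arXiv:2102.11518 —
  Thm. 4.18 (FJcycle.tex l. 2232–2245), its proof map (4.3), Prop. 4.13 («for every embedding τ'», l. 2113–2119).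
* [Deligne1971] P. Deligne, *Théorie de Hodge II*, Publ. Math. IHÉS 40 (1971), 2.1.4 (the real structure `conj ⊗ id`).
-/

set_option autoImplicit false

noncomputable section

namespace HodgeCM.Literature.Theta.LiuAlbaneseModuleDatum.D2Bridge

open HodgeCM.Literature.Theta HodgeCM.Literature.Theta.LiuAlbaneseModuleDatum

universe u v w u' v' w'

/-! ## §1 Abstract antilinear transport of `Thm418Combined` -/

section Abstract

/-- **Fixed vectors transport, conjugate-linear form.**  A conjugate-linear map `f : M → M'` from a `ℂ[G]`-module to a
`ℂ[G']`-module which is `φ`-semilinear on a subgroup `K ≤ G` (`f (k • x) = φ k • f x`, `k ∈ K`) maps `K`-fixed vectors to `K'`-fixed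
vectors for every `K' ≤ G'` covered by `φ(K)`. [folklore] -/
theorem map_mem_fixedBy_of_conjSemilinear {G : Type u} [Group G] {G' : Type u'} [Group G']
    {M : Type v} [AddCommGroup M] [Module ℂ M] [Module (MonoidAlgebra ℂ G) M] [IsScalarTower ℂ (MonoidAlgebra ℂ G) M]
    {M' : Type v'} [AddCommGroup M'] [Module ℂ M'] [Module (MonoidAlgebra ℂ G') M']
    [IsScalarTower ℂ (MonoidAlgebra ℂ G') M']
    (φ : G → G') (f : M →ₗ⋆[ℂ] M') {K : Subgroup G} {K' : Subgroup G'}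
    (hK : ∀ k' ∈ K', ∃ k ∈ K, φ k = k')
    (hf : ∀ k ∈ K, ∀ x : M, f (MonoidAlgebra.of ℂ G k • x) = MonoidAlgebra.of ℂ G' (φ k) • f x)
    {x : M} (hx : x ∈ fixedBy K M) : f x ∈ fixedBy K' M' := by
  intro k' hk'
  obtain ⟨k, hk, rfl⟩ := hK k' hk'
  rw [← hf k hk x, hx k hk]

variable {G : Type u} [Group G] {Lvl : Type v} {Kof : Lvl → Subgroup G}
variable {G' : Type u'} [Group G'] {Lvl' : Type v'} {Kof' : Lvl' → Subgroup G'}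

/-- **Isotypic images transport, conjugate-linear form.**  Along a group isomorphism `φ : G ≃* G'` and a `φ`-semilinear
CONJUGATE-linear map `eH : H → H'`, the sum `oscImage t` of the equivariant images of `ω(t)` in `H` is carried into `oscImage t'` as
soon as `ω(t')` maps `φ⁻¹`-semilinearly and CONJUGATE-linearly ONTO `ω(t)` (`θ`): every `ℂ[G]`-map `ψ : ω(t) → H` yields the
`ℂ`-LINEAR (composite of two conjugate-linear maps) `G'`-equivariant map `eH ∘ ψ ∘ θ : ω(t') → H'`, made `ℂ[G']`-linear by
`MonoidAlgebra.equivariantOfLinearOfComm`, with the same image under `eH`. [folklore] -/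
theorem map_oscImage_le_of_conjTransport (D : LiuAlbaneseModuleDatum G Kof) (D' : LiuAlbaneseModuleDatum G' Kof')
    (φ : G ≃* G') (eH : D.H →ₗ⋆[ℂ] D'.H)
    (heH : ∀ (g : G) (x : D.H), eH (MonoidAlgebra.of ℂ G g • x) = MonoidAlgebra.of ℂ G' (φ g) • eH x)
    (t : D.Triple) (t' : D'.Triple) (θ : D'.Ωt t' →ₗ⋆[ℂ] D.Ωt t) (hθ : Function.Surjective θ)
    (hθG : ∀ (g' : G') (y : D'.Ωt t'),
      θ (MonoidAlgebra.of ℂ G' g' • y) = MonoidAlgebra.of ℂ G (φ.symm g') • θ y) :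
    (D.oscImage t).map eH ≤ D'.oscImage t' := by
  unfold oscImage
  rw [Submodule.map_iSup]
  refine iSup_le fun ψ => ?_
  -- the composite of the two conjugate-linear maps `θ`, `eH` around the `ℂ[G]`-map `ψ` is `ℂ`-linear
  let Fψ : D'.Ωt t' →ₗ[ℂ] D'.H := eH.comp ((ψ.restrictScalars ℂ).comp θ)
  have hFψ : ∀ y : D'.Ωt t', Fψ y = eH (ψ (θ y)) := fun _ => rfl
  have hcomm : ∀ (g' : G') (y : D'.Ωt t'),
      Fψ (MonoidAlgebra.single g' (1 : ℂ) • y) = MonoidAlgebra.single g' (1 : ℂ) • Fψ y := by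
    intro g' y
    rw [hFψ, hFψ, ← MonoidAlgebra.of_apply, hθG, map_smul, heH, MulEquiv.apply_symm_apply]
  refine le_trans ?_ (le_iSup (fun ψ' : D'.Ωt t' →ₗ[MonoidAlgebra ℂ G'] D'.H => (LinearMap.range ψ').restrictScalars ℂ)
    (MonoidAlgebra.equivariantOfLinearOfComm Fψ hcomm))
  rintro _ ⟨y, hy, rfl⟩
  obtain ⟨z, rfl⟩ : ∃ z, ψ z = y := hy
  obtain ⟨w, rfl⟩ := hθ z
  exact ⟨w, (hFψ w).symm⟩

/-- **Blocks transport (one-sided), conjugate-linear form.**  `eH (block μ) ≤ block' μ'` as soon as every `ω(μ, a)` is a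
`φ⁻¹`-semilinear conjugate-linear QUOTIENT of some `ω'(μ', a')`. [folklore] -/
theorem map_block_le_of_conjTransport (D : LiuAlbaneseModuleDatum G Kof) (D' : LiuAlbaneseModuleDatum G' Kof')
    (φ : G ≃* G') (eH : D.H →ₗ⋆[ℂ] D'.H)
    (heH : ∀ (g : G) (x : D.H), eH (MonoidAlgebra.of ℂ G g • x) = MonoidAlgebra.of ℂ G' (φ g) • eH x)
    (μ : D.Char) (μ' : D'.Char)
    (hΩ : ∀ a : D.Adm μ, ∃ (a' : D'.Adm μ') (θ : D'.Ω μ' a' →ₗ⋆[ℂ] D.Ω μ a), Function.Surjective θ ∧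
      ∀ (g' : G') (y : D'.Ω μ' a'), θ (MonoidAlgebra.of ℂ G' g' • y) = MonoidAlgebra.of ℂ G (φ.symm g') • θ y) :
    (D.block μ).map eH ≤ D'.block μ' := by
  unfold block
  rw [Submodule.map_iSup]
  refine iSup_le fun a => ?_
  obtain ⟨a', θ, hθ, hθG⟩ := hΩ a
  exact le_trans (map_oscImage_le_of_conjTransport D D' φ eH heH ⟨μ, a⟩ ⟨μ', a'⟩ θ hθ hθG)
    (le_iSup (fun b : D'.Adm μ' => D'.oscImage ⟨μ', b⟩) a')

/-- **Blocks transport (two-sided), conjugate-linear form — the (T4) socket.**  Along `φ : G ≃* G'`, a `φ`-semilinear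
CONJUGATE-linear ISOMORPHISM `eH : H ≃ H'`, a bijection of the admissible completions `eA : Adm μ ≃ Adm' μ'` and `φ`-semilinear
conjugate-linear isomorphisms `eΩ a : ω(μ, a) ≃ₗ⋆[ℂ] ω'(μ', eA a)` («the complex conjugate of the oscillator module is the oscillator
module of the conjugate data»), the `μ`-block of `H` is carried ONTO the `μ'`-block of `H'`. [folklore] -/
theorem map_block_eq_of_conjTransport (D : LiuAlbaneseModuleDatum G Kof) (D' : LiuAlbaneseModuleDatum G' Kof')
    (φ : G ≃* G') (eH : D.H ≃ₗ⋆[ℂ] D'.H)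
    (heH : ∀ (g : G) (x : D.H), eH (MonoidAlgebra.of ℂ G g • x) = MonoidAlgebra.of ℂ G' (φ g) • eH x)
    (μ : D.Char) (μ' : D'.Char) (eA : D.Adm μ ≃ D'.Adm μ')
    (eΩ : ∀ a : D.Adm μ, D.Ω μ a ≃ₗ⋆[ℂ] D'.Ω μ' (eA a))
    (heΩ : ∀ (a : D.Adm μ) (g : G) (y : D.Ω μ a),
      eΩ a (MonoidAlgebra.of ℂ G g • y) = MonoidAlgebra.of ℂ G' (φ g) • eΩ a y) :
    (D.block μ).map (eH : D.H →ₗ⋆[ℂ] D'.H) = D'.block μ' := by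
  apply le_antisymm
  · refine map_block_le_of_conjTransport D D' φ (eH : D.H →ₗ⋆[ℂ] D'.H) (fun g x => heH g x) μ μ'
      fun a => ⟨eA a, ((eΩ a).symm : D'.Ω μ' (eA a) →ₗ⋆[ℂ] D.Ω μ a), (eΩ a).symm.surjective, fun g' y => ?_⟩
    change (eΩ a).symm _ = _ • (eΩ a).symm y
    apply (eΩ a).injective
    rw [LinearEquiv.apply_symm_apply, heΩ, MulEquiv.apply_symm_apply, LinearEquiv.apply_symm_apply]
  · have hsymm : ∀ (g' : G') (x' : D'.H), (eH.symm : D'.H →ₗ⋆[ℂ] D.H) (MonoidAlgebra.of ℂ G' g' • x') =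
        MonoidAlgebra.of ℂ G (φ.symm g') • (eH.symm : D'.H →ₗ⋆[ℂ] D.H) x' := by
      intro g' x'
      change eH.symm _ = _ • eH.symm x'
      apply eH.injective
      rw [LinearEquiv.apply_symm_apply, heH, MulEquiv.apply_symm_apply, LinearEquiv.apply_symm_apply]
    have h1 : (D'.block μ').map (eH.symm : D'.H →ₗ⋆[ℂ] D.H) ≤ D.block μ := by
      refine map_block_le_of_conjTransport D' D φ.symm (eH.symm : D'.H →ₗ⋆[ℂ] D.H) hsymm μ' μ fun a' => ?_
      obtain ⟨a, rfl⟩ := eA.surjective a'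
      refine ⟨a, (eΩ a : D.Ω μ a →ₗ⋆[ℂ] D'.Ω μ' (eA a)), (eΩ a).surjective, fun g y => ?_⟩
      change eΩ a _ = _ • eΩ a y
      rw [heΩ, MulEquiv.symm_symm]
    intro x' hx'
    exact ⟨eH.symm x', h1 ⟨x', hx', rfl⟩, eH.apply_symm_apply x'⟩

/-- **`Thm418Combined` transports along a CONJUGATE-linear package (pull-back form, weakest hypotheses).**  If `D'` satisfies the
combined reading r8 for `(res', cmCl')`, so does `D` for `(res, cmCl)`, along any package of maps `D → D'`: `φ : G → G'` covering
`Kof' (eL K)` by `φ (Kof K)`, a cofinal `eL : Lvl → Lvl'`, `eC : Char → Char'` preserving `PhiMu`, a conjugate-linear `eH : H → H'`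
`φ`-semilinear on each `Kof K` and carrying `block μ` into `block' (eC μ)`, and injective conjugate-linear `eW K : W K → W' (eL K)` with
`eW K ∘ res K = res' (eL K) ∘ eH` and `cmCl' (eL K) (eC μ) ⊆ eW K '' cmCl K μ`.  PROOF: unfold; chase one vector; the span law is
`Submodule.map_span` for the surjective ring endomorphism `starRingEnd ℂ`. [folklore] -/
theorem thm418Combined_of_conjTransport [Preorder Lvl] [Preorder Lvl']
    (D : LiuAlbaneseModuleDatum G Kof) (D' : LiuAlbaneseModuleDatum G' Kof')
    {W : Lvl → Type w} [∀ K, AddCommGroup (W K)] [∀ K, Module ℂ (W K)]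
    {W' : Lvl' → Type w'} [∀ K', AddCommGroup (W' K')] [∀ K', Module ℂ (W' K')]
    (res : ∀ K : Lvl, D.H →ₗ[ℂ] W K) (cmCl : ∀ K : Lvl, D.Char → Set (W K))
    (res' : ∀ K' : Lvl', D'.H →ₗ[ℂ] W' K') (cmCl' : ∀ K' : Lvl', D'.Char → Set (W' K'))
    (φ : G → G') (eL : Lvl → Lvl') (eC : D.Char → D'.Char) (eH : D.H →ₗ⋆[ℂ] D'.H)
    (eW : ∀ K : Lvl, W K →ₗ⋆[ℂ] W' (eL K))
    (hcof : ∀ K₀' : Lvl', ∃ K₀ : Lvl, ∀ K ≤ K₀, eL K ≤ K₀')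
    (hK : ∀ (K : Lvl), ∀ k' ∈ Kof' (eL K), ∃ k ∈ Kof K, φ k = k')
    (heH : ∀ (K : Lvl), ∀ k ∈ Kof K, ∀ x : D.H,
      eH (MonoidAlgebra.of ℂ G k • x) = MonoidAlgebra.of ℂ G' (φ k) • eH x)
    (hPhi : ∀ μ : D.Char, D.PhiMu μ → D'.PhiMu (eC μ))
    (hblock : ∀ μ : D.Char, (D.block μ).map eH ≤ D'.block (eC μ))
    (hres : ∀ (K : Lvl) (x : D.H), eW K (res K x) = res' (eL K) (eH x))
    (hW : ∀ K : Lvl, Function.Injective (eW K))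
    (hcm : ∀ (K : Lvl) (μ : D.Char), cmCl' (eL K) (eC μ) ⊆ eW K '' cmCl K μ)
    (h : D'.Thm418Combined res' cmCl') : D.Thm418Combined res cmCl := by
  intro μ hμ
  obtain ⟨K₀', hK₀'⟩ := h (eC μ) (hPhi μ hμ)
  obtain ⟨K₀, hK₀⟩ := hcof K₀'
  refine ⟨K₀, fun K hKle x hxb hxf => ?_⟩
  have h1 : eH x ∈ D'.block (eC μ) := hblock μ ⟨x, hxb, rfl⟩
  have h2 : eH x ∈ fixedBy (Kof' (eL K)) D'.H := map_mem_fixedBy_of_conjSemilinear φ eH (hK K) (heH K) hxf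
  have h3 : eW K (res K x) ∈ (Submodule.span ℂ (cmCl K μ)).map (eW K) := by
    rw [Submodule.map_span, hres]
    exact Submodule.span_mono (hcm K μ) (hK₀' (eL K) (hK₀ K hKle) (eH x) h1 h2)
  obtain ⟨y, hy, hyx⟩ := h3
  rwa [← hW K hyx]

/-- **`Thm418Combined` transports along a CONJUGATE-linear package (push-forward form).**  If `D` satisfies the combined reading r8
for `(res, cmCl)`, so does `D'` for `(res', cmCl')`, along `φ : G → G'` with `φ (Kof K) ≤ Kof' (eL K)`, an order ISOMORPHISM of levels
`eL`, a SURJECTION of characters `eC` reflecting `PhiMu`, a conjugate-linear ISOMORPHISM `eH` `φ`-semilinear on each `Kof K` with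
`block' (eC μ) ≤ eH (block μ)`, and conjugate-linear `eW K` with `eW K ∘ res K = res' (eL K) ∘ eH`, `eW K '' cmCl K μ ⊆ cmCl' (eL K) (eC μ)`.
[folklore] -/
theorem thm418Combined_conjTransport_of [Preorder Lvl] [Preorder Lvl']
    (D : LiuAlbaneseModuleDatum G Kof) (D' : LiuAlbaneseModuleDatum G' Kof')
    {W : Lvl → Type w} [∀ K, AddCommGroup (W K)] [∀ K, Module ℂ (W K)]
    {W' : Lvl' → Type w'} [∀ K', AddCommGroup (W' K')] [∀ K', Module ℂ (W' K')]
    (res : ∀ K : Lvl, D.H →ₗ[ℂ] W K) (cmCl : ∀ K : Lvl, D.Char → Set (W K))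
    (res' : ∀ K' : Lvl', D'.H →ₗ[ℂ] W' K') (cmCl' : ∀ K' : Lvl', D'.Char → Set (W' K'))
    (φ : G → G') (eL : Lvl ≃o Lvl') (eC : D.Char → D'.Char) (hC : Function.Surjective eC)
    (eH : D.H ≃ₗ⋆[ℂ] D'.H) (eW : ∀ K : Lvl, W K →ₗ⋆[ℂ] W' (eL K))
    (hK : ∀ (K : Lvl), ∀ k ∈ Kof K, φ k ∈ Kof' (eL K))
    (heH : ∀ (K : Lvl), ∀ k ∈ Kof K, ∀ x : D.H,
      eH (MonoidAlgebra.of ℂ G k • x) = MonoidAlgebra.of ℂ G' (φ k) • eH x)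
    (hPhi : ∀ μ : D.Char, D'.PhiMu (eC μ) → D.PhiMu μ)
    (hblock : ∀ μ : D.Char, D'.block (eC μ) ≤ (D.block μ).map (eH : D.H →ₗ⋆[ℂ] D'.H))
    (hres : ∀ (K : Lvl) (x : D.H), eW K (res K x) = res' (eL K) (eH x))
    (hcm : ∀ (K : Lvl) (μ : D.Char), eW K '' cmCl K μ ⊆ cmCl' (eL K) (eC μ))
    (h : D.Thm418Combined res cmCl) : D'.Thm418Combined res' cmCl' := by
  intro μ' hμ'
  obtain ⟨μ, rfl⟩ := hC μ'
  obtain ⟨K₀, hK₀⟩ := h μ (hPhi μ hμ')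
  refine ⟨eL K₀, fun K' hK'le x' hxb' hxf' => ?_⟩
  obtain ⟨K, rfl⟩ := eL.surjective K'
  obtain ⟨x, rfl⟩ := eH.surjective x'
  have hKle : K ≤ K₀ := eL.le_iff_le.mp hK'le
  have hxb : x ∈ D.block μ := by
    obtain ⟨y, hy, hyx⟩ := hblock μ hxb'
    rwa [← eH.injective hyx]
  have hxf : x ∈ fixedBy (Kof K) D.H := by
    intro k hk
    apply eH.injective
    rw [heH K k hk]
    exact hxf' (φ k) (hK K k hk)
  have h3 : eW K (res K x) ∈ (Submodule.span ℂ (cmCl K μ)).map (eW K) := ⟨_, hK₀ K hKle x hxb hxf, rfl⟩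
  rw [Submodule.map_span, hres] at h3
  exact Submodule.span_mono (hcm K μ) h3

/-- **`Thm418Combined` is INVARIANT under CONJUGATE-linear transport of all its data** (the two forms combined): along a group
isomorphism `φ : G ≃* G'` with `Kof' (eL K) = φ (Kof K)`, an order isomorphism of levels `eL`, a bijection of characters `eC` with
`PhiMu μ ↔ PhiMu' (eC μ)`, a `φ`-semilinear conjugate-linear isomorphism of carriers `eH` with `eH (block μ) = block' (eC μ)` (e.g. from
`map_block_eq_of_conjTransport`), and conjugate-linear isomorphisms `eW K : W K ≃ W' (eL K)` with `eW K ∘ res K = res' (eL K) ∘ eH` and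
`cmCl' (eL K) (eC μ) = eW K '' cmCl K μ`: `D.Thm418Combined res cmCl ↔ D'.Thm418Combined res' cmCl'`. [folklore] -/
theorem thm418Combined_iff_of_conjTransport [Preorder Lvl] [Preorder Lvl']
    (D : LiuAlbaneseModuleDatum G Kof) (D' : LiuAlbaneseModuleDatum G' Kof')
    {W : Lvl → Type w} [∀ K, AddCommGroup (W K)] [∀ K, Module ℂ (W K)]
    {W' : Lvl' → Type w'} [∀ K', AddCommGroup (W' K')] [∀ K', Module ℂ (W' K')]
    (res : ∀ K : Lvl, D.H →ₗ[ℂ] W K) (cmCl : ∀ K : Lvl, D.Char → Set (W K))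
    (res' : ∀ K' : Lvl', D'.H →ₗ[ℂ] W' K') (cmCl' : ∀ K' : Lvl', D'.Char → Set (W' K'))
    (φ : G ≃* G') (eL : Lvl ≃o Lvl') (eC : D.Char ≃ D'.Char) (eH : D.H ≃ₗ⋆[ℂ] D'.H)
    (eW : ∀ K : Lvl, W K ≃ₗ⋆[ℂ] W' (eL K))
    (hK : ∀ K : Lvl, Kof' (eL K) = (Kof K).map φ.toMonoidHom)
    (heH : ∀ (g : G) (x : D.H), eH (MonoidAlgebra.of ℂ G g • x) = MonoidAlgebra.of ℂ G' (φ g) • eH x)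
    (hPhi : ∀ μ : D.Char, D.PhiMu μ ↔ D'.PhiMu (eC μ))
    (hblock : ∀ μ : D.Char, (D.block μ).map (eH : D.H →ₗ⋆[ℂ] D'.H) = D'.block (eC μ))
    (hres : ∀ (K : Lvl) (x : D.H), eW K (res K x) = res' (eL K) (eH x))
    (hcm : ∀ (K : Lvl) (μ : D.Char), cmCl' (eL K) (eC μ) = eW K '' cmCl K μ) :
    D.Thm418Combined res cmCl ↔ D'.Thm418Combined res' cmCl' := by
  constructor
  · refine thm418Combined_conjTransport_of D D' res cmCl res' cmCl' φ eL eC eC.surjective eH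
      (fun K => (eW K : W K →ₗ⋆[ℂ] W' (eL K))) (fun K k hk => ?_) (fun K k _ x => heH k x)
      (fun μ => (hPhi μ).2) (fun μ => (hblock μ).ge) (fun K x => hres K x) (fun K μ => (hcm K μ).ge)
    rw [hK K]
    exact ⟨k, hk, rfl⟩
  · refine thm418Combined_of_conjTransport D D' res cmCl res' cmCl' φ eL eC (eH : D.H →ₗ⋆[ℂ] D'.H)
      (fun K => (eW K : W K →ₗ⋆[ℂ] W' (eL K))) (fun K₀' => ⟨eL.symm K₀', fun K hK => ?_⟩) (fun K k' hk' => ?_)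
      (fun K k _ x => heH k x) (fun μ => (hPhi μ).1) (fun μ => (hblock μ).le) (fun K x => hres K x)
      (fun K => (eW K).injective) (fun K μ => (hcm K μ).le)
    · simpa using eL.monotone hK
    · rw [hK K] at hk'
      obtain ⟨k, hk, rfl⟩ := hk'
      exact ⟨k, hk, rfl⟩

end Abstract

end HodgeCM.Literature.Theta.LiuAlbaneseModuleDatum.D2Bridge

end
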